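import Literature.RingTheory.CohomologyAnnihilator.SyzygyBasic
import HarnessLib

/-!
# Syzygies of the tower: `M ∈ |G|ₙ ⟹ Ω M ∈ |Ω G ⊕ A|ₙ`

Topic: `Literature/RingTheory/CohomologyAnnihilator`. The step "viewing `G` as an `R`-module, it
follows that `N/aN` is in `|G|ₙ`, and hence that `Ω_R(N/aN)` is in `|Ω_R G|ₙ`" of the proof of
[IyengarTakahashi2014, Theorem 5.1] (and [DaoTakahashi2014, Prop. 5.3]): syzygies of modules in
the tower `|G|ₙ` lie in the tower built from a syzygy of `G` (and `A`, which absorbs the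
projective summands by which syzygies are ambiguous). Precisely, for `G` finitely generated with a
first syzygy `K_G` and `G' = K_G ⊕ A`:

* `exists_isSyzygy_one_inTower` — every `M ∈ |G|ₙ` has SOME first syzygy in `|G'|ₙ` (induction on
  the tower using the horseshoe lemma and Schanuel);
* `inTower_of_isSyzygy_one` — for `n ≥ 1`, EVERY first syzygy of `M ∈ |G|ₙ` lies in `|G'|ₙ`;
* `exists_generator_isSyzygy_inTower` — iterating (`A` noetherian): for each `j` there is a
  finitely generated `G_j` with `Ωʲ M ∈ |G_j|ₙ` for all `M ∈ |G|ₙ`, `n ≥ 1`, and all choices of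
  `Ωʲ M`.

## References

* S. B. Iyengar, R. Takahashi, *Annihilation of cohomology and strong generation of module
  categories*, IMRN 2016; arXiv:1404.1476 — proof of Theorem 5.1. [`IyengarTakahashi2014`]
* H. Dao, R. Takahashi, *The radius of a subcategory of modules*, Algebra Number Theory 8 (2014),
  Proposition 5.3. [`DaoTakahashi2014`]
-/

noncomputable section

open CategoryTheory CategoryTheory.Limits

universe u

namespace Literature.RingTheory.CohomologyAnnihilator

variable {A : Type u} [CommRing A]

/-! ## Projectives and powers in `add G` -/

/-- A finitely generated projective module lies in `add G` as soon as `A` does. [folklore] -/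
theorem IsRetractOfPower.of_projective {G Q : ModuleCat.{u} A}
    (hA : IsRetractOfPower G (ModuleCat.of A A)) (hQ : Module.Finite A Q) (hproj : Projective Q) :
    IsRetractOfPower G Q := by
  haveI := hQ
  haveI := moduleProjective_of_projective Q hproj
  obtain ⟨n, π, hπ⟩ := Module.Finite.exists_fin' A Q
  obtain ⟨s, hs⟩ := Module.projective_lifting_property π LinearMap.id hπ
  refine (hA.pi n).of_retract (ModuleCat.ofHom s) (ModuleCat.ofHom π) ?_
  apply ModuleCat.hom_ext
  exact hs

/-- Powers of syzygies: `Kᵐ` is a first syzygy of `Mᵐ`. [folklore] -/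
theorem IsSyzygy.pi {M K : ModuleCat.{u} A} (h : IsSyzygy 1 M K) :
    ∀ m : ℕ, IsSyzygy 1 (ModuleCat.of A (Fin m → M)) (ModuleCat.of A (Fin m → K))
  | 0 => isSyzygy_one_of_isZero (ModuleCat.isZero_of_subsingleton _)
      (ModuleCat.isZero_of_subsingleton _)
  | m + 1 => ((h.prod (h.pi m)).of_iso
      (Fin.consLinearEquiv A (fun _ : Fin (m + 1) => (K : Type u))).toModuleIso).of_iso_base
      (Fin.consLinearEquiv A (fun _ : Fin (m + 1) => (M : Type u))).toModuleIso

/-- `A` is a retract of `K_G ⊕ A`. [folklore] -/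
theorem isRetractOfPower_prod_right (KG : ModuleCat.{u} A) :
    IsRetractOfPower (ModuleCat.of A (KG × A)) (ModuleCat.of A A) :=
  (isRetractOfPower_self _).of_retract (ModuleCat.ofHom (LinearMap.inr A KG A))
    (ModuleCat.ofHom (LinearMap.snd A KG A)) (by apply ModuleCat.hom_ext; exact LinearMap.ext fun _ => rfl)

/-- `K_G` is a retract of `K_G ⊕ A`. [folklore] -/
theorem isRetractOfPower_prod_left (KG : ModuleCat.{u} A) :
    IsRetractOfPower (ModuleCat.of A (KG × A)) KG :=
  (isRetractOfPower_self _).of_retract (ModuleCat.ofHom (LinearMap.inl A KG A))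
    (ModuleCat.ofHom (LinearMap.fst A KG A)) (by apply ModuleCat.hom_ext; exact LinearMap.ext fun _ => rfl)

/-- **Syzygies of `add G`**: if `X ∈ add G`, `K_G = Ω G` and `K_X = Ω X` (any first syzygies),
then `K_X ∈ add (K_G ⊕ A)`. [folklore] -/
theorem isRetractOfPower_of_isSyzygy_of_isRetractOfPower {G KG X KX : ModuleCat.{u} A}
    (hKG : IsSyzygy 1 G KG) (hX : IsRetractOfPower G X) (hKX : IsSyzygy 1 X KX) :
    IsRetractOfPower (ModuleCat.of A (KG × A)) KX := by
  obtain ⟨m, i, p, hip⟩ := hX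
  obtain ⟨Q, hQ, hQproj, i', p', hip'⟩ := exists_retract_isSyzygy_of_retract i p hip (hKG.pi m) hKX
  refine IsRetractOfPower.of_retract ?_ i' p' hip'
  exact ((isRetractOfPower_prod_left KG).pi m).prod
    (IsRetractOfPower.of_projective (isRetractOfPower_prod_right KG) hQ hQproj)

/-! ## Syzygies of the tower -/

/-- **Some first syzygy of `M ∈ |G|ₙ` lies in `|Ω G ⊕ A|ₙ`** (`G` finitely generated, `Ω G = K_G`
any first syzygy): induction on `n` along `0 → Y → M ⊕ W → X → 0`, taking the horseshoe of
syzygies of `Y` (inductive hypothesis) and of `X ∈ add G` (previous lemma), which is a first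
syzygy of `M ⊕ W` in `|Ω G ⊕ A|ₙ`, and comparing with `Ω M ⊕ Ω W` by Schanuel.
[cite: IyengarTakahashi2014, Thm. 5.1 (proof); DaoTakahashi2014, Prop. 5.3] -/
theorem exists_isSyzygy_one_inTower {G KG : ModuleCat.{u} A} [Module.Finite A G]
    (hKG : IsSyzygy 1 G KG) :
    ∀ {n : ℕ} {M : ModuleCat.{u} A}, InTower G n M →
      ∃ K : ModuleCat.{u} A, IsSyzygy 1 M K ∧ InTower (ModuleCat.of A (KG × A)) n K
  | 0, _, hM => ⟨ModuleCat.of A PUnit.{u + 1},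
      isSyzygy_one_of_isZero hM (ModuleCat.isZero_of_subsingleton _),
      show InTower _ 0 _ from ModuleCat.isZero_of_subsingleton _⟩
  | n + 1, M, ⟨W, Y, X, hY, hX, f, g, w, hS⟩ => by
    obtain ⟨KY, hKY, hKYT⟩ := exists_isSyzygy_one_inTower hKG hY
    haveI := hX.finite
    obtain ⟨KX, hKX⟩ := exists_isSyzygy_one X
    have hKXadd := isRetractOfPower_of_isSyzygy_of_isRetractOfPower hKG hX hKX
    obtain ⟨E, hE, f', g', w', hS'⟩ := exists_isSyzygy_one_of_shortExact hS hKY hKX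
    have hET : InTower (ModuleCat.of A (KG × A)) (n + 1) E :=
      inTower_succ_of_shortExact hKYT hKXadd hS'
    haveI : Module.Finite A (ModuleCat.of A (M × W)) := finite_of_isSyzygy_one hE
    haveI : Module.Finite A M :=
      Module.Finite.of_surjective (LinearMap.fst A M W) Prod.fst_surjective
    haveI : Module.Finite A W :=
      Module.Finite.of_surjective (LinearMap.snd A M W) Prod.snd_surjective
    obtain ⟨K, hK⟩ := exists_isSyzygy_one M
    obtain ⟨KW, hKW⟩ := exists_isSyzygy_one W
    obtain ⟨P₁, P₂, hP₁, hproj₁, -, -, ⟨ε⟩⟩ := (hK.prod hKW).exists_stablyIso_one hE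
    have hEP : InTower (ModuleCat.of A (KG × A)) (n + 1) (ModuleCat.of A (E × P₁)) :=
      hET.prod_of_isRetractOfPower (Nat.succ_pos n)
        (IsRetractOfPower.of_projective (isRetractOfPower_prod_right KG) hP₁ hproj₁)
    refine ⟨K, hK, (hEP.of_iso ε.symm).of_retract
      (ModuleCat.ofHom ((LinearMap.inl A _ P₂) ∘ₗ LinearMap.inl A K KW))
      (ModuleCat.ofHom (LinearMap.fst A K KW ∘ₗ LinearMap.fst A _ P₂)) ?_⟩
    apply ModuleCat.hom_ext
    exact LinearMap.ext fun _ => rfl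

/-- **Every first syzygy of `M ∈ |G|ₙ` lies in `|Ω G ⊕ A|ₙ`**, for `n ≥ 1` (Schanuel: any two first
syzygies differ by finitely generated projective summands, which `|Ω G ⊕ A|ₙ` absorbs).
[cite: IyengarTakahashi2014, Thm. 5.1 (proof); DaoTakahashi2014, Prop. 5.3] -/
theorem inTower_of_isSyzygy_one {G KG : ModuleCat.{u} A} [Module.Finite A G] (hKG : IsSyzygy 1 G KG)
    {n : ℕ} (hn : 1 ≤ n) {M K : ModuleCat.{u} A} (hM : InTower G n M) (hK : IsSyzygy 1 M K) :
    InTower (ModuleCat.of A (KG × A)) n K := by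
  obtain ⟨K₀, hK₀, hT⟩ := exists_isSyzygy_one_inTower hKG hM
  obtain ⟨P₁, P₂, hP₁, hproj₁, -, -, ⟨ε⟩⟩ := hK.exists_stablyIso_one hK₀
  have hKP : InTower (ModuleCat.of A (KG × A)) n (ModuleCat.of A (K₀ × P₁)) :=
    hT.prod_of_isRetractOfPower hn
      (IsRetractOfPower.of_projective (isRetractOfPower_prod_right KG) hP₁ hproj₁)
  refine (hKP.of_iso ε.symm).of_retract (ModuleCat.ofHom (LinearMap.inl A K P₂))
    (ModuleCat.ofHom (LinearMap.fst A K P₂)) ?_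
  apply ModuleCat.hom_ext
  exact LinearMap.ext fun _ => rfl

/-- **Higher syzygies of the tower**: over a noetherian ring, for `G` finitely generated and every
`j` there is a finitely generated `G_j` (namely `Ω(⋯ Ω(Ω G ⊕ A) ⊕ A ⋯) ⊕ A`) such that every
`j`-th syzygy of every `M ∈ |G|ₙ`, `n ≥ 1`, lies in `|G_j|ₙ`.
[cite: IyengarTakahashi2014, Thm. 5.1 (proof); DaoTakahashi2014, Cor. 5.5] -/
theorem exists_generator_isSyzygy_inTower [IsNoetherianRing A] (G : ModuleCat.{u} A)
    [Module.Finite A G] :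
    ∀ j : ℕ, ∃ G' : ModuleCat.{u} A, Module.Finite A G' ∧
      ∀ {n : ℕ}, 1 ≤ n → ∀ {M K : ModuleCat.{u} A}, InTower G n M → IsSyzygy j M K →
        InTower G' n K
  | 0 => ⟨G, inferInstance, fun _ _ _ hM ⟨i⟩ => hM.of_iso i.symm⟩
  | j + 1 => by
    obtain ⟨G₁, hG₁, h₁⟩ := exists_generator_isSyzygy_inTower G j
    haveI := hG₁
    obtain ⟨KG₁, hKG₁⟩ := exists_isSyzygy_one G₁
    haveI : Module.Finite A KG₁ := by
      obtain ⟨P, hP, -, f, g, w, hS⟩ := isSyzygy_one_iff.mp hKG₁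
      haveI := hP
      exact Module.Finite.of_injective f.hom hS.moduleCat_injective_f
    refine ⟨ModuleCat.of A (KG₁ × A), inferInstance, fun hn M K hM hK => ?_⟩
    obtain ⟨K', P, hK', hP, hproj, f, g, w, hS⟩ := hK
    exact inTower_of_isSyzygy_one hKG₁ hn (h₁ hn hM hK')
      (isSyzygy_one_iff.mpr ⟨P, hP, hproj, f, g, w, hS⟩)

end Literature.RingTheory.CohomologyAnnihilator

end
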